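import Literature.Geometry.Riemannian.HopfRinowHeineBorel
import HarnessLib

/-!
# A Riemannian metric which dominates a complete one is complete

For two Riemannian metrics `g₁ ≤ g₂` (pointwise as quadratic forms, `g₁(v,v) ≤ g₂(v,v)`) on the
same connected manifold without boundary:

* `PseudoRiemannianMetric.length_le_of_val_le` — arc lengths compare, `L_{g₁}(γ) ≤ L_{g₂}(γ)`
  (O'Neill 1983, Ch. 5, Def. 11: `|v|_g = g(v,v)^{1/2}`);
* `PseudoRiemannianMetric.edist_le_of_val_le` — hence so do the Riemannian distances,
  `d_{g₁} ≤ d_{g₂}` (O'Neill 1983, Ch. 5, Def. 15: the infimum of lengths);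
* `isGeodesicallyComplete_of_val_le` — **if `g₁` is geodesically complete then so is `g₂`**: by the
  Hopf–Rinow theorem (O'Neill 1983, Ch. 5, Thm. 21, (C) ⇔ (HB), the tree's
  `isGeodesicallyComplete_iff_isCompact_setOf_edist_le`) completeness is the compactness of the
  closed distance balls, and a closed `d_{g₂}`-ball is a closed subset of the `d_{g₁}`-ball of the
  same radius. (Gordon 1973, p. 222, remarks that a metric "larger" than a complete metric is
  complete; this is the form in which completeness of a spacelike hypersurface of Minkowski
  space-time passes to the Euclidean metric pulled back by its projection to `{t = 0}`.)

Everything is proved; no definitions, no named facts (D-0026).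

## References

* B. O'Neill, *Semi-Riemannian geometry*, Academic Press 1983, Ch. 5, Def. 11, Def. 15,
  Thm. 21 (Hopf–Rinow). [ONeill1983]
* W. B. Gordon, *An analytical criterion for the completeness of Riemannian manifolds*, Proc.
  Amer. Math. Soc. 37 (1973) 221–225. [Gordon1973]
-/

noncomputable section

open Bundle Set Filter Manifold MeasureTheory
open scoped Manifold ContDiff Topology ENNReal NNReal

namespace Literature.Geometry.Riemannian

open Literature.Geometry.Lorentzian
open Literature.Geometry.Lorentzian.PseudoRiemannianMetric

variable {E : Type*} [NormedAddCommGroup E] [NormedSpace ℝ E] {H : Type*} [TopologicalSpace H]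
  {I : ModelWithCorners ℝ E H} {M : Type*} [TopologicalSpace M] [ChartedSpace H M]
  [IsManifold I ∞ M] {n : ℕ∞ω} [FiniteDimensional ℝ E]
  {g₁ g₂ : PseudoRiemannianMetric I n E (TangentSpace I : M → Type _)}

/-! ### Lengths and distances are monotone in the metric -/

/-- **Arc length is monotone in the metric**: if `g₁(v, v) ≤ g₂(v, v)` for all tangent vectors
then `L_{g₁}(γ|[a,b]) ≤ L_{g₂}(γ|[a,b])` for every curve `γ` (O'Neill 1983, Ch. 5, Def. 11:
`L(γ) = ∫ |γ'|`, `|v| = g(v,v)^{1/2}`, and `√·` is monotone). [cite: ONeill1983, Ch. 5, Def. 11 (p. 131)] -/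
theorem _root_.Literature.Geometry.Lorentzian.PseudoRiemannianMetric.length_le_of_val_le
    (h₁ : g₁.IsRiemannian) (h₂ : g₂.IsRiemannian)
    (hle : ∀ (x : M) (v : TangentSpace I x), g₁.val x v v ≤ g₂.val x v v) (γ : ℝ → M)
    (a b : ℝ) : g₁.length h₁ γ a b ≤ g₂.length h₂ γ a b := by
  rw [length_eq_lintegral, length_eq_lintegral]
  exact lintegral_mono fun t ↦ ENNReal.ofReal_le_ofReal (Real.sqrt_le_sqrt (hle _ _))

/-- **The Riemannian distance is monotone in the metric**: if `g₁(v, v) ≤ g₂(v, v)` for all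
tangent vectors then `d_{g₁}(x, y) ≤ d_{g₂}(x, y)` (O'Neill 1983, Ch. 5, Def. 15: both are infima
of lengths over the same `C¹` curves, and `L_{g₁} ≤ L_{g₂}`, `length_le_of_val_le`).
[cite: ONeill1983, Ch. 5, Def. 15 (p. 134)] -/
theorem _root_.Literature.Geometry.Lorentzian.PseudoRiemannianMetric.edist_le_of_val_le
    (h₁ : g₁.IsRiemannian) (h₂ : g₂.IsRiemannian)
    (hle : ∀ (x : M) (v : TangentSpace I x), g₁.val x v v ≤ g₂.val x v v) (x y : M) :
    g₁.edist h₁ x y ≤ g₂.edist h₂ x y := by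
  refine le_of_forall_gt_imp_ge_of_dense fun r hr ↦ ?_
  -- an almost minimising `C¹` curve for `g₂`
  letI := g₂.riemannianBundle h₂
  obtain ⟨γ, hγ0, hγ1, hγs, hlen⟩ := exists_lt_of_riemannianEDist_lt (I := I) (x := x) (y := y) hr
  have hlen' : g₂.length h₂ γ 0 1 < r := hlen
  calc g₁.edist h₁ x y = g₁.edist h₁ (γ 0) (γ 1) := by rw [hγ0, hγ1]
    _ ≤ g₁.length h₁ γ 0 1 := edist_le_length _ zero_le_one hγs
    _ ≤ g₂.length h₂ γ 0 1 := length_le_of_val_le h₁ h₂ hle γ 0 1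
    _ ≤ r := hlen'.le

/-! ### Completeness passes to dominating metrics -/

variable [CompleteSpace E] [T2Space M] [ConnectedSpace M] [BoundarylessManifold I M]

/-- **A Riemannian metric dominating a geodesically complete Riemannian metric is geodesically
complete.** Let `g₁ ≤ g₂` be smooth Riemannian metrics on a connected Hausdorff manifold without
boundary, `g₁(v,v) ≤ g₂(v,v)` for all `v`, and suppose the Levi-Civita connection of `g₁` is
geodesically complete. Then so is that of `g₂`. Proof: by Hopf–Rinow (O'Neill 1983, Ch. 5,
Thm. 21, (C) ⇔ (HB); `isGeodesicallyComplete_iff_isCompact_setOf_edist_le`) it suffices that the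
closed balls `{d_{g₂}(p, ·) ≤ r}` are compact; they are closed (the distance is continuous,
Prop. 18) and contained in the compact balls `{d_{g₁}(p, ·) ≤ r}` since `d_{g₁} ≤ d_{g₂}`
(`edist_le_of_val_le`). (Gordon 1973, p. 222.) [cite: ONeill1983, Ch. 5, Thm. 21] -/
theorem isGeodesicallyComplete_of_val_le [g₁.HasLeviCivita] [g₂.HasLeviCivita]
    (hn : (∞ : ℕ∞ω) ≤ n) (h₁ : g₁.IsRiemannian) (h₂ : g₂.IsRiemannian)
    (hle : ∀ (x : M) (v : TangentSpace I x), g₁.val x v v ≤ g₂.val x v v)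
    (hc : IsGeodesicallyComplete g₁.leviCivita) : IsGeodesicallyComplete g₂.leviCivita := by
  haveI : Fact (1 ≤ n) := ⟨le_trans (by exact_mod_cast le_top) hn⟩
  haveI : LocallyCompactSpace M := Manifold.locallyCompact_of_finiteDimensional I
  haveI : RegularSpace M := inferInstance
  have hk : ((1 : ℕ∞) : ℕ∞ω) + 1 ≤ n := le_trans (by exact_mod_cast le_top) hn
  haveI : CovariantDerivative.ContMDiffCovariantDerivative g₁.leviCivita 1 :=
    ⟨g₁.isLocallyContMDiff_leviCivita_holds 1 hk univ isOpen_univ⟩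
  haveI : CovariantDerivative.ContMDiffCovariantDerivative g₂.leviCivita 1 :=
    ⟨g₂.isLocallyContMDiff_leviCivita_holds 1 hk univ isOpen_univ⟩
  rw [isGeodesicallyComplete_iff_isCompact_setOf_edist_le g₂ hn h₂]
  intro p r
  have hclosed : IsClosed {q | g₂.edist h₂ p q ≤ r} :=
    isClosed_le ((PseudoRiemannianMetric.continuous_edist h₂).comp (Continuous.prodMk_right p))
      continuous_const
  exact isCompact_of_isClosed_of_edist_le g₁ hn h₁ hc hclosed p r fun q hq ↦
    (edist_le_of_val_le h₁ h₂ hle p q).trans hq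

end Literature.Geometry.Riemannian

end
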